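import Literature.AlgebraicGeometry.Resolution.ExcellentRings
import Mathlib.RingTheory.AdicCompletion.AsTensorProduct
import Mathlib.RingTheory.AdicCompletion.Exactness
import Mathlib.RingTheory.AdicCompletion.LocalRing
import Mathlib.RingTheory.AdicCompletion.Noetherian
import Mathlib.RingTheory.Artinian.Module
import Mathlib.LinearAlgebra.FreeModule.Basic
import Mathlib.RingTheory.Flat.Basic
import Mathlib.RingTheory.SurjectiveOnStalks
import Mathlib.RingTheory.Localization.LocalizationLocalization
import Mathlib.RingTheory.Localization.Submodule
import Mathlib.RingTheory.LocalRing.RingHom.Basic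
import HarnessLib

/-!
# Excellent rings: proofs

Topic: `Literature/AlgebraicGeometry/Resolution`. Companion of `ExcellentRings.lean` (proofs
only, no new notions).

## 1. Sanity of the definitions

The trivial cases of Grothendieck's conditions, showing that the vendored
`IsGeometricallyRegular` / `IsRegularHom` / `IsGRing` are inhabited with their intended meaning.

* `isGeometricallyRegular_of_algEquiv` — if `C ≅ F` as `F`-algebras then `K ⊗_F C` is
  geometrically regular over any extension field `K` of `F`.
* `isRegularHom_of_algEquiv` — an `F`-algebra isomorphic to the field `F` is a regular
  `F`-algebra (flat, geometrically regular fibres).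
* `isGRing_of_field` — a field is a G-ring (Matsumura §32, p. 257: "`k` is a field, and so
  trivially a G-ring"): every localisation `k_𝔭` is again a field, adically complete for its
  (zero) maximal ideal, so `k_𝔭 → (k_𝔭)^` is an isomorphism.

## 2. A quotient of a G-ring is a G-ring (`Matsumura1987_32_quotient_holds`)

The first step of Matsumura's proof of the Corollary to Thm. 32.6 (p. 260: "It follows from
the definition that a quotient or localisation of a G-ring is again a G-ring"), PROVED, which
discharges the named fact `Matsumura1987_32_quotient` of `ExcellentRings.lean` and reduces
`Matsumura1987_32_6_cor` to the single named fact `Matsumura1987_32_polynomial`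
(`k[X_1, …, X_n]` is a G-ring): `Matsumura1987_32_6_cor_of_polynomial`. The proof
("from the definition") is the standard one: for a surjection `A → B` and a prime `𝔮` of `B`
over `𝔭`, `R = A_𝔭 → R' = B_𝔮` is a surjection of Noetherian local rings, and

* `adicCompletionChangeOfRings` — change of rings for adic completions: the `I`-adic
  completion of an `S`-module `M` viewed as an `R`-module is its `IS`-adic completion
  (`R → S`);
* `completionMap` — the induced map `ψ : R^ → R'^` (universal property
  `AdicCompletion.liftAlgHom`), which under the change of rings is the functorial map
  `AdicCompletion.map` (`changeOfRings_map_eq_completionMap`), hence surjective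
  (`AdicCompletion.map_surjective`) with kernel generated by `ker (R → R')`
  (`one_tmul_eq_zero_of_completionMap_eq_zero`, from the exactness of adic completion on
  finite modules over a Noetherian ring, `AdicCompletion.map_exact`, and
  `AdicCompletion.ofTensorProduct`);
* `completionBaseChangeEquiv` — consequently `R' ⊗_R R^ ≃ R'^` as `R'`-algebras;
* `isGeometricallyRegular_fibre_completion_of_surjective` — the fibre of `R' → R'^` over a
  prime `𝔮'` is the fibre of `R → R^` over `𝔮' ∩ R` (same residue field,
  `RingHom.SurjectiveOnStalks.residueFieldMap_bijective`), via
  `L ⊗_{κ(𝔮')} (κ(𝔮') ⊗_{R'} R'^) ≅ L ⊗_{R'} R'^ ≅ L ⊗_R R^ ≅ L ⊗_{κ(𝔭')} (κ(𝔭') ⊗_R R^)`;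
* `IsRegularHom.completion_of_surjective` — so `R' → R'^` is regular if `R → R^` is
  (flatness of `R' → R'^` being automatic, `AdicCompletion.flat_of_isNoetherian`);
* `isGRing_of_surjective`, `IsGRing.of_ringEquiv`, `Matsumura1987_32_quotient_holds`.

## 3. A localisation of a G-ring is a G-ring (`Matsumura1987_32_localization_holds`)

The other half of the same sentence, PROVED: for a prime `𝔮` of `B = S⁻¹A` over `𝔭`,
`B_𝔮 ≅ A_𝔭` (`IsLocalization.isLocalization_isLocalization_atPrime_isLocalization`), and an
isomorphism is a surjection, so the local form applies again: `isGRing_of_isLocalization`,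
`Matsumura1987_32_localization_holds`.

## 4. Consequences for `Matsumura1987_32_6_cor`

`Matsumura1987_32_6_cor` (finitely generated algebras over a field are G-rings) and the
localisation half of Matsumura's Corollary now follow from the single named fact
`Matsumura1987_32_polynomial` (`k[X_1, …, X_n]` is a G-ring; Matsumura Thm. 32.6 (Mizutani) with
Thms. 30.3, 30.5 — the deep input, needing the Jacobian criteria of §30):
`Matsumura1987_32_6_cor_of_polynomial`, `Matsumura1987_32_6_cor_localization_of_polynomial`;
conversely `Matsumura1987_32_6_cor.matsumura1987_32_polynomial` records that the reduction is
an equivalence.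

[cite: Matsumura1987, §32 p. 257; §32 p. 260, Cor. of Thm. 32.6 and its proof]
-/

noncomputable section

open IsLocalRing TensorProduct

namespace Literature.AlgebraicGeometry.Resolution

universe u

/-! ## 1. Sanity of the definitions -/

/-- If `C ≅ F` as algebras over the field `F`, then for every extension field `K` of `F` the
base change `K ⊗_F C` is geometrically regular over `K` (`k' ⊗_K (K ⊗_F C) ≅ k'` is a field).
[folklore] -/
theorem isGeometricallyRegular_of_algEquiv (F K C : Type u) [Field F] [Field K] [Algebra F K]
    [CommRing C] [Algebra F C] (e : C ≃ₐ[F] F) : IsGeometricallyRegular K (K ⊗[F] C) := by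
  intro k' _ _ _
  have e₁ : K ⊗[F] C ≃ₐ[K] K ⊗[F] F := Algebra.TensorProduct.congr AlgEquiv.refl e
  have e₂ : K ⊗[F] F ≃ₐ[K] K := Algebra.TensorProduct.rid F K K
  have e₃ : k' ⊗[K] (K ⊗[F] C) ≃ₐ[K] k' ⊗[K] K :=
    Algebra.TensorProduct.congr AlgEquiv.refl (e₁.trans e₂)
  have e₄ : k' ⊗[K] K ≃ₐ[K] k' := Algebra.TensorProduct.rid K K k'
  exact IsRegularRing.of_ringEquiv (e₃.trans e₄).symm.toRingEquiv

/-- An algebra over a field `F` which is `F`-isomorphic to `F` is a regular `F`-algebra: flat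
(a vector space) with geometrically regular fibres. [folklore] -/
theorem isRegularHom_of_algEquiv (F C : Type u) [Field F] [CommRing C] [Algebra F C]
    (e : C ≃ₐ[F] F) : IsRegularHom F C :=
  ⟨inferInstance, fun p _ => isGeometricallyRegular_of_algEquiv F p.ResidueField C e⟩

/-- **A field is a G-ring** (Matsumura §32, p. 257: "`k` is a field, and so trivially a
G-ring"). Every prime of `k` is `0`, `k_𝔭` is a field, hence Artinian local and so adically
complete for its maximal ideal `0`; the completion map is the isomorphism
`AdicCompletion.ofAlgEquiv`. [cite: Matsumura1987, §32 p. 257] -/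
theorem isGRing_of_field (k : Type u) [Field k] : IsGRing k := by
  refine ⟨inferInstance, fun p _ => ?_⟩
  have h0 : (0 : k) ∉ p.primeCompl := fun h => h p.zero_mem
  have hL : IsField (Localization.AtPrime p) :=
    MulEquiv.isField (Field.toIsField k)
      (RingEquiv.ofBijective (algebraMap k (Localization.AtPrime p))
        (IsField.localization_map_bijective h0 (Field.toIsField k))).symm.toMulEquiv
  letI : Field (Localization.AtPrime p) := hL.toField
  exact isRegularHom_of_algEquiv (Localization.AtPrime p) _
    (AdicCompletion.ofAlgEquiv (maximalIdeal (Localization.AtPrime p))).symm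

/-! ## 2. A quotient of a G-ring is a G-ring -/

/-! ### Change of rings for adic completions -/

section ChangeOfRings

variable {R S : Type*} [CommRing R] [CommRing S] [Algebra R S] (I : Ideal R) (J : Ideal S)
  (M : Type*) [AddCommGroup M] [Module S M] [Module R M] [IsScalarTower R S M]
  (hIJ : I.map (algebraMap R S) = J)

include hIJ in
/-- `IⁿM = JⁿM` (as additive subgroups of `M`) when `J = IS`. [folklore] -/
theorem pow_smul_top_eq_restrictScalars (n : ℕ) :
    (I ^ n • ⊤ : Submodule R M) = (J ^ n • ⊤ : Submodule S M).restrictScalars R := by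
  rw [← hIJ, ← Ideal.map_pow, Submodule.restrictScalars_map_smul_eq,
    Submodule.restrictScalars_top]

/-- `M ⧸ IⁿM ≃ M ⧸ JⁿM` over `R`, when `J = IS`. [folklore] -/
def quotPowSMulEquiv (n : ℕ) :
    (M ⧸ (I ^ n • ⊤ : Submodule R M)) ≃ₗ[R] M ⧸ (J ^ n • ⊤ : Submodule S M) :=
  (Submodule.quotEquivOfEq _ _ (pow_smul_top_eq_restrictScalars I J M hIJ n)).trans
    (Submodule.Quotient.restrictScalarsEquiv R (J ^ n • ⊤ : Submodule S M))

/-- `quotPowSMulEquiv` is the identity on representatives. [folklore] -/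
@[simp] theorem quotPowSMulEquiv_mk (n : ℕ) (x : M) :
    quotPowSMulEquiv I J M hIJ n (Submodule.Quotient.mk x) = Submodule.Quotient.mk x := rfl

/-- `quotPowSMulEquiv.symm` is the identity on representatives. [folklore] -/
@[simp] theorem quotPowSMulEquiv_symm_mk (n : ℕ) (x : M) :
    (quotPowSMulEquiv I J M hIJ n).symm (Submodule.Quotient.mk x) = Submodule.Quotient.mk x := by
  rw [LinearEquiv.symm_apply_eq, quotPowSMulEquiv_mk]

/-- Change of rings for the adic completion: the `I`-adic completion of the `R`-module `M`
is the `J`-adic completion of the `S`-module `M` when `J = IS` (the two inverse systems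
`M ⧸ IⁿM`, `M ⧸ JⁿM` coincide; cf. Matsumura Thm. 8.13 for the topologies). [folklore] -/
def adicCompletionChangeOfRings : AdicCompletion I M ≃ₗ[R] AdicCompletion J M where
  toFun x := ⟨fun n => quotPowSMulEquiv I J M hIJ n (x.val n), fun {m n} hmn => by
    obtain ⟨y, hy⟩ := Submodule.Quotient.mk_surjective _ (x.val n)
    have hm : x.val m = Submodule.Quotient.mk y := by
      rw [← x.property hmn, ← hy]; rfl
    simp only [← hy, hm, quotPowSMulEquiv_mk]
    rfl⟩
  map_add' x y := by ext n; simp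
  map_smul' r x := by ext n; simp [AdicCompletion.val_smul_apply]
  invFun x := ⟨fun n => (quotPowSMulEquiv I J M hIJ n).symm (x.val n), fun {m n} hmn => by
    obtain ⟨y, hy⟩ := Submodule.Quotient.mk_surjective _ (x.val n)
    have hm : x.val m = Submodule.Quotient.mk y := by
      rw [← x.property hmn, ← hy]; rfl
    simp only [← hy, hm, quotPowSMulEquiv_symm_mk]
    rfl⟩
  left_inv x := by ext n; simp
  right_inv x := by ext n; simp

/-- Components of `adicCompletionChangeOfRings`. [folklore] -/
@[simp] theorem adicCompletionChangeOfRings_val (x : AdicCompletion I M) (n : ℕ) :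
    (adicCompletionChangeOfRings I J M hIJ x).val n = quotPowSMulEquiv I J M hIJ n (x.val n) := rfl

/-- `adicCompletionChangeOfRings` commutes with the canonical maps from `M`. [folklore] -/
@[simp] theorem adicCompletionChangeOfRings_of (x : M) :
    adicCompletionChangeOfRings I J M hIJ (AdicCompletion.of I M x) = AdicCompletion.of J M x := by
  ext n; rfl

end ChangeOfRings

/-! ### Completion of a quotient of a Noetherian local ring -/

section LocalSurjection

variable {R R' : Type u} [CommRing R] [CommRing R'] [IsLocalRing R] [IsLocalRing R']
  [Algebra R R'] (hφ : Function.Surjective (algebraMap R R'))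

include hφ in
/-- A surjection of local rings maps the maximal ideal onto the maximal ideal. [folklore] -/
theorem map_maximalIdeal_eq_of_surjective :
    (maximalIdeal R).map (algebraMap R R') = maximalIdeal R' :=
  IsLocalRing.map_maximalIdeal_of_surjective _ hφ

include hφ in
/-- `𝔪ⁿ ⊆ φ⁻¹(𝔪'ⁿ)` for the surjection `φ : R → R'`. [folklore] -/
theorem maximalIdeal_pow_le_comap (n : ℕ) :
    maximalIdeal R ^ n ≤ (maximalIdeal R' ^ n).comap (algebraMap R R') := by
  rw [← Ideal.map_le_iff_le_comap, Ideal.map_pow, map_maximalIdeal_eq_of_surjective hφ]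

/-- The level-`n` maps `R^ → R ⧸ 𝔪ⁿ → R' ⧸ 𝔪'ⁿ`. [folklore] -/
def completionToQuotPow (n : ℕ) :
    AdicCompletion (maximalIdeal R) R →ₐ[R] R' ⧸ maximalIdeal R' ^ n :=
  (Ideal.quotientMapₐ (maximalIdeal R' ^ n) (Algebra.ofId R R')
    (maximalIdeal_pow_le_comap hφ n)).comp (AdicCompletion.evalₐ (maximalIdeal R) n)

/-- `completionToQuotPow` on the class of a Cauchy sequence `a` is `φ(aₙ) mod 𝔪'ⁿ`. [folklore] -/
theorem completionToQuotPow_mk (n : ℕ)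
    (a : AdicCompletion.AdicCauchySequence (maximalIdeal R) R) :
    completionToQuotPow hφ n (AdicCompletion.mk (maximalIdeal R) R a) =
      Ideal.Quotient.mk (maximalIdeal R' ^ n) (algebraMap R R' (a.val n)) := by
  simp [completionToQuotPow]

/-- The maps `completionToQuotPow n` are compatible with the transition maps
`R' ⧸ 𝔪'ⁿ → R' ⧸ 𝔪'ᵏ`. [folklore] -/
theorem completionToQuotPow_compat {k n : ℕ} (hkn : k ≤ n) :
    (Ideal.Quotient.factorₐ R (Ideal.pow_le_pow_right hkn)).comp (completionToQuotPow hφ n) =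
      completionToQuotPow hφ k := by
  ext x
  induction x using AdicCompletion.induction_on with
  | h a =>
    simp only [AlgHom.coe_comp, Function.comp_apply, completionToQuotPow_mk,
      Ideal.Quotient.factorₐ_apply_mk]
    have h := AdicCompletion.Ideal.mk_eq_mk (maximalIdeal R) hkn a
    rw [Ideal.Quotient.eq] at h ⊢
    rw [← map_sub]
    have hmem : algebraMap R R' (a.val n - a.val k) ∈
        (maximalIdeal R ^ k).map (algebraMap R R') :=
      Ideal.mem_map_of_mem _ h
    rwa [Ideal.map_pow, map_maximalIdeal_eq_of_surjective hφ] at hmem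

/-- The map `ψ : R^ → R'^` induced on completions by the surjection `R → R'` (universal
property of the adic completion, `AdicCompletion.liftAlgHom`). [folklore] -/
def completionMap :
    AdicCompletion (maximalIdeal R) R →ₐ[R] AdicCompletion (maximalIdeal R') R' :=
  AdicCompletion.liftAlgHom (maximalIdeal R') (completionToQuotPow hφ)
    (completionToQuotPow_compat hφ)

/-- Components of `completionMap`. [folklore] -/
theorem completionMap_val (x : AdicCompletion (maximalIdeal R) R) (n : ℕ) :
    (completionMap hφ x).val n =
      Ideal.Quotient.factor (le_of_eq (Ideal.mul_top _).symm) (completionToQuotPow hφ n x) :=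
  rfl

/-- `completionMap` on the class of a Cauchy sequence `a` has `n`-th component `φ(aₙ)`.
[folklore] -/
theorem completionMap_mk_val (a : AdicCompletion.AdicCauchySequence (maximalIdeal R) R)
    (n : ℕ) :
    (completionMap hφ (AdicCompletion.mk (maximalIdeal R) R a)).val n =
      Ideal.Quotient.mk (maximalIdeal R' ^ n • ⊤ : Ideal R') (algebraMap R R' (a.val n)) := by
  rw [completionMap_val, completionToQuotPow_mk, Ideal.Quotient.factor_mk]
  rfl

/-- `completionMap` is, under the change-of-rings identification, the functorial map
`AdicCompletion.map 𝔪 (R → R')` of `𝔪`-adic completions of `R`-modules. [folklore] -/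
theorem changeOfRings_map_eq_completionMap (x : AdicCompletion (maximalIdeal R) R) :
    adicCompletionChangeOfRings (maximalIdeal R) (maximalIdeal R') R'
      (map_maximalIdeal_eq_of_surjective hφ)
      (AdicCompletion.map (maximalIdeal R) (Algebra.linearMap R R') x) = completionMap hφ x := by
  induction x using AdicCompletion.induction_on with
  | h a =>
    ext n
    rw [completionMap_mk_val, adicCompletionChangeOfRings_val, AdicCompletion.map_val_apply]
    simp only [AdicCompletion.mk_apply_coe, Submodule.mkQ_apply]
    rw [LinearMap.reduceModIdeal_apply, quotPowSMulEquiv_mk]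
    rfl

include hφ in
/-- `R^ → R'^` is surjective for `R → R'` surjective (adic completion preserves surjections,
`AdicCompletion.map_surjective`; Matsumura §32, p. 255: "`(A/I)^* = A^*/IA^*`").
[cite: Matsumura1987, §32 p. 255] -/
theorem completionMap_surjective : Function.Surjective (completionMap hφ) := by
  intro y
  obtain ⟨x, hx⟩ := AdicCompletion.map_surjective (maximalIdeal R) (f := Algebra.linearMap R R')
    hφ ((adicCompletionChangeOfRings (maximalIdeal R) (maximalIdeal R') R'
      (map_maximalIdeal_eq_of_surjective hφ)).symm y)
  refine ⟨x, ?_⟩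
  rw [← changeOfRings_map_eq_completionMap, hx, LinearEquiv.apply_symm_apply]

/-- The base change map `θ : R' ⊗_R R^ → R'^`, `a ⊗ x ↦ a · ψ(x)`. [folklore] -/
def completionBaseChange :
    R' ⊗[R] AdicCompletion (maximalIdeal R) R →ₐ[R'] AdicCompletion (maximalIdeal R') R' :=
  Algebra.TensorProduct.lift (Algebra.ofId R' _) (completionMap hφ) fun _ _ => Commute.all _ _

/-- `θ (a ⊗ x) = a · ψ(x)`. [folklore] -/
@[simp] theorem completionBaseChange_tmul (a : R') (x : AdicCompletion (maximalIdeal R) R) :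
    completionBaseChange hφ (a ⊗ₜ x) = algebraMap R' _ a * completionMap hφ x :=
  Algebra.TensorProduct.lift_tmul _ _ _ a x

omit [IsLocalRing R'] in
include hφ in
/-- Every element of `R' ⊗_R R^` is an elementary tensor `1 ⊗ x` (`R → R'` is surjective).
[folklore] -/
theorem exists_eq_one_tmul (t : R' ⊗[R] AdicCompletion (maximalIdeal R) R) :
    ∃ x : AdicCompletion (maximalIdeal R) R, t = 1 ⊗ₜ x := by
  induction t using TensorProduct.induction_on with
  | zero => exact ⟨0, (tmul_zero _ _).symm⟩
  | tmul a x =>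
    obtain ⟨r, rfl⟩ := hφ a
    exact ⟨r • x, by rw [Algebra.algebraMap_eq_smul_one, smul_tmul]⟩
  | add t₁ t₂ h₁ h₂ =>
    obtain ⟨x₁, rfl⟩ := h₁
    obtain ⟨x₂, rfl⟩ := h₂
    exact ⟨x₁ + x₂, (tmul_add _ _ _).symm⟩

omit [IsLocalRing R'] [Algebra R R'] in
/-- In `R^` (as a module over itself via `AdicCompletion.module`), `r • ι(s) = s • r`,
componentwise. [folklore] -/
theorem smul_of_eq_smul (r : AdicCompletion (maximalIdeal R) R) (s : R) (n : ℕ) :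
    (r.val n • (AdicCompletion.of (maximalIdeal R) R s).val n :
        R ⧸ (maximalIdeal R ^ n • ⊤ : Ideal R)) = (s • r).val n := by
  induction r using AdicCompletion.induction_on with
  | h a =>
    change ((a.val n : R) • (AdicCompletion.of (maximalIdeal R) R s).val n :
        R ⧸ (maximalIdeal R ^ n • ⊤ : Ideal R)) =
      (s • AdicCompletion.mk (maximalIdeal R) R a).val n
    rw [AdicCompletion.val_smul_apply]
    simp only [AdicCompletion.of_apply, AdicCompletion.mk_apply_coe, Submodule.mkQ_apply,
      ← Submodule.Quotient.mk_smul, smul_eq_mul, mul_comm]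

omit [IsLocalRing R'] [Algebra R R'] in
/-- `AdicCompletion.ofTensorProduct` on `R^ ⊗ R`: `r ⊗ s ↦ s • r`. [folklore] -/
theorem ofTensorProduct_tmul_eq_smul (r : AdicCompletion (maximalIdeal R) R) (s : R) :
    AdicCompletion.ofTensorProduct (maximalIdeal R) R (r ⊗ₜ s) = s • r := by
  rw [AdicCompletion.ofTensorProduct_tmul]
  ext n
  rw [AdicCompletion.smul_eval]
  exact smul_of_eq_smul r s n

variable [IsNoetherianRing R]

include hφ in
/-- The kernel of `R^ → R'^` is generated by `ker (R → R')`, in the form: if `x ↦ 0` then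
`1 ⊗ x = 0` in `R' ⊗_R R^` (exactness of adic completion on finite modules over a
Noetherian ring, `AdicCompletion.map_exact`, and `J^ = J R^`, `AdicCompletion.ofTensorProduct`;
Matsumura Thms. 8.7 and 8.11: `M ⊗_A Â ≅ M̂`, `(JM)^ = J M̂` for finite `M` over Noetherian `A`).
[cite: Matsumura1987, Thm. 8.11] -/
theorem one_tmul_eq_zero_of_completionMap_eq_zero {x : AdicCompletion (maximalIdeal R) R}
    (hx : completionMap hφ x = 0) : (1 : R') ⊗ₜ[R] x = 0 := by
  set J : Submodule R R := LinearMap.ker (Algebra.linearMap R R') with hJ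
  have hmap : AdicCompletion.map (maximalIdeal R) (Algebra.linearMap R R') x = 0 := by
    rw [← (adicCompletionChangeOfRings (maximalIdeal R) (maximalIdeal R') R'
      (map_maximalIdeal_eq_of_surjective hφ)).map_eq_zero_iff,
      changeOfRings_map_eq_completionMap hφ, hx]
  have hexact : Function.Exact (AdicCompletion.map (maximalIdeal R) J.subtype)
      (AdicCompletion.map (maximalIdeal R) (Algebra.linearMap R R')) :=
    AdicCompletion.map_exact J.injective_subtype (LinearMap.exact_subtype_ker_map _) hφ
  obtain ⟨z, rfl⟩ := (hexact x).mp hmap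
  obtain ⟨t, rfl⟩ := AdicCompletion.ofTensorProduct_surjective_of_finite (maximalIdeal R) J z
  have hnat :=
    LinearMap.congr_fun (AdicCompletion.ofTensorProduct_naturality (maximalIdeal R) J.subtype) t
  simp only [LinearMap.coe_comp, Function.comp_apply] at hnat
  rw [hnat]
  clear hnat hmap hx hexact
  induction t using TensorProduct.induction_on with
  | zero => simp
  | add t₁ t₂ h₁ h₂ => rw [map_add, map_add, tmul_add, h₁, h₂, add_zero]
  | tmul r j =>
    simp only [TensorProduct.AlgebraTensorModule.map_tmul, LinearMap.id_coe, id_eq,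
      Submodule.coe_subtype]
    have hj : algebraMap R R' (j : R) = 0 := j.2
    rw [ofTensorProduct_tmul_eq_smul, ← smul_tmul, Algebra.smul_def, mul_one, hj, zero_tmul]

include hφ in
/-- `θ : R' ⊗_R R^ → R'^` is bijective. [cite: Matsumura1987, §32 p. 255] -/
theorem completionBaseChange_bijective : Function.Bijective (completionBaseChange hφ) := by
  constructor
  · rw [injective_iff_map_eq_zero]
    intro t ht
    obtain ⟨x, rfl⟩ := exists_eq_one_tmul hφ t
    rw [completionBaseChange_tmul, map_one, one_mul] at ht
    exact one_tmul_eq_zero_of_completionMap_eq_zero hφ ht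
  · intro y
    obtain ⟨x, rfl⟩ := completionMap_surjective hφ y
    exact ⟨1 ⊗ₜ x, by rw [completionBaseChange_tmul, map_one, one_mul]⟩

/-- **The completion of a quotient of a Noetherian local ring is the base change of the
completion**: `R' ⊗_R R^ ≃ R'^` as `R'`-algebras, for `R → R'` surjective (Matsumura §32,
p. 255: "If `I` is an ideal of `A` then `(A/I)^* = A^*/IA^*`"; Thm. 8.7: `M ⊗_A Â ≅ M̂`).
[cite: Matsumura1987, §32 p. 255] -/
def completionBaseChangeEquiv :
    R' ⊗[R] AdicCompletion (maximalIdeal R) R ≃ₐ[R'] AdicCompletion (maximalIdeal R') R' :=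
  AlgEquiv.ofBijective (completionBaseChange hφ) (completionBaseChange_bijective hφ)

include hφ in
omit [IsNoetherianRing R] [IsLocalRing R] [IsLocalRing R'] in
/-- The residue field map `κ(𝔮 ∩ R) → κ(𝔮)` of the surjection `R → R'` is bijective. [folklore] -/
theorem residueFieldMap_bijective_of_surjective (q : Ideal R') [q.IsPrime] :
    Function.Bijective
      (Ideal.ResidueField.map (q.comap (algebraMap R R')) q (algebraMap R R') rfl) :=
  (RingHom.surjectiveOnStalks_of_surjective hφ).residueFieldMap_bijective _ q rfl

include hφ in
/-- **Fibres.** For a prime `𝔮` of `R'` over `𝔭 = 𝔮 ∩ R`, the fibre of `R' → R'^` over `𝔮` is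
geometrically regular over `κ(𝔮)` as soon as the fibre of `R → R^` over `𝔭` is geometrically
regular over `κ(𝔭) = κ(𝔮)`: for a finite extension `L` of `κ(𝔮)`,
`L ⊗_{κ(𝔮)} (κ(𝔮) ⊗_{R'} R'^) ≅ L ⊗_{R'} R'^ ≅ L ⊗_{R'} (R' ⊗_R R^) ≅ L ⊗_R R^
 ≅ L ⊗_{κ(𝔭)} (κ(𝔭) ⊗_R R^)` (Matsumura §32, p. 255: "a formal fibre of `A/I` is also a formal
fibre of `A`"). [cite: Matsumura1987, §32 p. 255] -/
theorem isGeometricallyRegular_fibre_completion_of_surjective (q : Ideal R') [q.IsPrime]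
    (H : IsGeometricallyRegular (q.comap (algebraMap R R')).ResidueField
      ((q.comap (algebraMap R R')).ResidueField ⊗[R] AdicCompletion (maximalIdeal R) R)) :
    IsGeometricallyRegular q.ResidueField
      (q.ResidueField ⊗[R'] AdicCompletion (maximalIdeal R') R') := by
  intro L _ _ hL
  haveI := hL
  set p := q.comap (algebraMap R R') with hp
  let ρ : p.ResidueField →+* q.ResidueField := Ideal.ResidueField.map p q (algebraMap R R') rfl
  have hρ : Function.Bijective ρ := residueFieldMap_bijective_of_surjective hφ q
  letI : Algebra p.ResidueField L := ((algebraMap q.ResidueField L).comp ρ).toAlgebra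
  haveI : Module.Finite p.ResidueField L := by
    have h₁ : (algebraMap q.ResidueField L).Finite := RingHom.finite_algebraMap.mpr hL
    have h₂ : ρ.Finite := RingHom.Finite.of_surjective ρ hρ.2
    exact h₁.comp h₂
  haveI : IsRegularRing
      (L ⊗[p.ResidueField] (p.ResidueField ⊗[R] AdicCompletion (maximalIdeal R) R)) :=
    H L inferInstance
  letI : Algebra R' L :=
    ((algebraMap q.ResidueField L).comp (algebraMap R' q.ResidueField)).toAlgebra
  haveI : IsScalarTower R' q.ResidueField L := IsScalarTower.of_algebraMap_eq fun _ => rfl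
  letI : Algebra R L := ((algebraMap R' L).comp (algebraMap R R')).toAlgebra
  haveI : IsScalarTower R R' L := IsScalarTower.of_algebraMap_eq fun _ => rfl
  haveI : IsScalarTower R p.ResidueField L := by
    refine IsScalarTower.of_algebraMap_eq fun r => ?_
    change algebraMap q.ResidueField L (algebraMap R' q.ResidueField (algebraMap R R' r)) =
      algebraMap q.ResidueField L (ρ (algebraMap R p.ResidueField r))
    rw [Ideal.ResidueField.map_algebraMap]
  let e₁ : L ⊗[q.ResidueField] (q.ResidueField ⊗[R'] AdicCompletion (maximalIdeal R') R') ≃ₐ[L]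
      L ⊗[R'] AdicCompletion (maximalIdeal R') R' :=
    Algebra.TensorProduct.cancelBaseChange R' q.ResidueField L L _
  let e₂ : L ⊗[R'] AdicCompletion (maximalIdeal R') R' ≃ₐ[L]
      L ⊗[R'] (R' ⊗[R] AdicCompletion (maximalIdeal R) R) :=
    Algebra.TensorProduct.congr AlgEquiv.refl (completionBaseChangeEquiv hφ).symm
  let e₃ : L ⊗[R'] (R' ⊗[R] AdicCompletion (maximalIdeal R) R) ≃ₐ[L]
      L ⊗[R] AdicCompletion (maximalIdeal R) R :=
    Algebra.TensorProduct.cancelBaseChange R R' L L _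
  let e₄ : L ⊗[p.ResidueField] (p.ResidueField ⊗[R] AdicCompletion (maximalIdeal R) R) ≃ₐ[L]
      L ⊗[R] AdicCompletion (maximalIdeal R) R :=
    Algebra.TensorProduct.cancelBaseChange R p.ResidueField L L _
  have e : L ⊗[p.ResidueField] (p.ResidueField ⊗[R] AdicCompletion (maximalIdeal R) R) ≃+*
      L ⊗[q.ResidueField] (q.ResidueField ⊗[R'] AdicCompletion (maximalIdeal R') R') :=
    ((e₁.trans (e₂.trans e₃)).trans e₄.symm).symm.toRingEquiv
  exact IsRegularRing.of_ringEquiv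
    (R := L ⊗[p.ResidueField] (p.ResidueField ⊗[R] AdicCompletion (maximalIdeal R) R)) e

include hφ in
/-- **Local form of "a quotient of a G-ring is a G-ring".** If `R → R'` is a surjection of
Noetherian local rings and `R → R^` is a regular homomorphism, then so is `R' → R'^`:
flatness is automatic (`AdicCompletion.flat_of_isNoetherian`), and the fibres of `R' → R'^`
are fibres of `R → R^` because `R'^ = R' ⊗_R R^`.
[cite: Matsumura1987, §32 p. 260, proof of Cor. of Thm. 32.6] -/
theorem IsRegularHom.completion_of_surjective [IsNoetherianRing R']
    (h : IsRegularHom R (AdicCompletion (maximalIdeal R) R)) :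
    IsRegularHom R' (AdicCompletion (maximalIdeal R') R') :=
  ⟨AdicCompletion.flat_of_isNoetherian _, fun q _ =>
    isGeometricallyRegular_fibre_completion_of_surjective hφ q (h.2 _)⟩

end LocalSurjection

/-! ### A quotient of a G-ring is a G-ring -/

/-- **A quotient of a G-ring is a G-ring** (Matsumura, *Commutative Ring Theory*, §32,
p. 260, first sentence of the proof of the Corollary to Thm. 32.6: "It follows from the
definition that a quotient or localisation of a G-ring is again a G-ring"). For a prime `𝔮` of
`B = A/I` over `𝔭`, `B_𝔮 = A_𝔭 / I A_𝔭` and the local form applies.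
[cite: Matsumura1987, §32 p. 260, proof of Cor. of Thm. 32.6] -/
theorem isGRing_of_surjective {A B : Type u} [CommRing A] [CommRing B] (f : A →+* B)
    (hf : Function.Surjective f) (hA : IsGRing A) : IsGRing B := by
  haveI : IsNoetherianRing A := hA.1
  haveI : IsNoetherianRing B := isNoetherianRing_of_surjective A B f hf
  refine ⟨inferInstance, fun q _ => ?_⟩
  letI : Algebra (Localization.AtPrime (q.comap f)) (Localization.AtPrime q) :=
    (Localization.localRingHom (q.comap f) q f rfl).toAlgebra
  have hsurj : Function.Surjective
      (algebraMap (Localization.AtPrime (q.comap f)) (Localization.AtPrime q)) :=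
    RingHom.surjectiveOnStalks_of_surjective hf q inferInstance
  exact IsRegularHom.completion_of_surjective hsurj (hA.2 (q.comap f))

/-- Being a G-ring is invariant under ring isomorphisms (an isomorphism is a surjection).
[folklore] -/
theorem IsGRing.of_ringEquiv {A B : Type u} [CommRing A] [CommRing B] (e : A ≃+* B)
    (hA : IsGRing A) : IsGRing B :=
  isGRing_of_surjective e.toRingHom e.surjective hA

/-- DISCHARGE of the named fact `Matsumura1987_32_quotient` (`ExcellentRings.lean`): a quotient
of a G-ring is a G-ring. [cite: Matsumura1987, §32 p. 260, proof of Cor. of Thm. 32.6] -/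
theorem Matsumura1987_32_quotient_holds : Matsumura1987_32_quotient.{u} :=
  fun _A _B _ _ f hf hA => isGRing_of_surjective f hf hA

/-! ## 3. A localisation of a G-ring is a G-ring -/

/-- **A localisation of a G-ring is a G-ring** (Matsumura §32, p. 260, same sentence). For a
prime `𝔮` of `B = S⁻¹A` over `𝔭 = 𝔮 ∩ A`, `B_𝔮` is a localisation of `A` at `𝔭`, whence an
`A`-isomorphism `A_𝔭 ≅ B_𝔮`; an isomorphism is a surjection of Noetherian local rings, so the
local form `IsRegularHom.completion_of_surjective` applies.
[cite: Matsumura1987, §32 p. 260, proof of Cor. of Thm. 32.6] -/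
theorem isGRing_of_isLocalization {A B : Type u} [CommRing A] [CommRing B] [Algebra A B]
    (S : Submonoid A) [IsLocalization S B] (hA : IsGRing A) : IsGRing B := by
  haveI : IsNoetherianRing A := hA.1
  haveI : IsNoetherianRing B := IsLocalization.isNoetherianRing S B inferInstance
  refine ⟨inferInstance, fun q _ => ?_⟩
  haveI : IsScalarTower A B (Localization.AtPrime q) := IsScalarTower.of_algebraMap_eq' rfl
  haveI : IsLocalization.AtPrime (Localization.AtPrime q) (q.comap (algebraMap A B)) :=
    IsLocalization.isLocalization_isLocalization_atPrime_isLocalization S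
      (Localization.AtPrime q) q
  let e : Localization.AtPrime (q.comap (algebraMap A B)) ≃ₐ[A] Localization.AtPrime q :=
    IsLocalization.algEquiv (q.comap (algebraMap A B)).primeCompl _ _
  letI : Algebra (Localization.AtPrime (q.comap (algebraMap A B))) (Localization.AtPrime q) :=
    e.toAlgHom.toRingHom.toAlgebra
  exact IsRegularHom.completion_of_surjective e.surjective (hA.2 (q.comap (algebraMap A B)))

/-- DISCHARGE of the named fact `Matsumura1987_32_localization` (`ExcellentRings.lean`): a
localisation of a G-ring is a G-ring.
[cite: Matsumura1987, §32 p. 260, proof of Cor. of Thm. 32.6] -/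
theorem Matsumura1987_32_localization_holds : Matsumura1987_32_localization.{u} :=
  fun _A _B _ _ _ S hS hA => @isGRing_of_isLocalization _ _ _ _ _ S hS hA

/-! ## 4. Consequences for `Matsumura1987_32_6_cor` -/

/-- `Matsumura1987_32_6_cor` (finitely generated algebras over a field are G-rings) follows
from the single named fact `Matsumura1987_32_polynomial` (`k[X_1, …, X_n]` is a G-ring;
Matsumura Thm. 32.6 with Thms. 30.3, 30.5). [cite: Matsumura1987, Cor. of Thm. 32.6, p. 260] -/
theorem Matsumura1987_32_6_cor_of_polynomial (hp : Matsumura1987_32_polynomial.{u}) :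
    Matsumura1987_32_6_cor.{u} :=
  Matsumura1987_32_6_cor_of_quotient_of_polynomial Matsumura1987_32_quotient_holds hp

/-- The localisation half of Matsumura's Corollary to Thm. 32.6 ("… or a localisation of such a
ring, is a G-ring") from the single named fact `Matsumura1987_32_polynomial`.
[cite: Matsumura1987, Cor. of Thm. 32.6, p. 260] -/
theorem Matsumura1987_32_6_cor_localization_of_polynomial (hp : Matsumura1987_32_polynomial.{u})
    (k A B : Type u) [Field k] [CommRing A] [Algebra k A] [CommRing B] [Algebra A B]
    (S : Submonoid A) [IsLocalization S B] (hA : Algebra.FiniteType k A) : IsGRing B :=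
  Matsumura1987_32_6_cor_localization Matsumura1987_32_quotient_holds
    Matsumura1987_32_localization_holds hp k A B S hA

/-- Conversely `Matsumura1987_32_6_cor` contains `Matsumura1987_32_polynomial`
(`k[X_1, …, X_n]` is of finite type over `k`): the decomposition of `ExcellentRings.lean` is
equi-strong with the original fact. [folklore] -/
theorem Matsumura1987_32_6_cor.matsumura1987_32_polynomial (h : Matsumura1987_32_6_cor.{u}) :
    Matsumura1987_32_polynomial.{u} :=
  fun k _ n => h k (MvPolynomial (Fin n) k) inferInstance

end Literature.AlgebraicGeometry.Resolution

end
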